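import Mathlib
import HarnessLib
import HarnessLib.Audit
import Summits.AtomisticToContinuum.Statement
import Literature.Analysis.FluidPDE.HardSphereFlowConstruction
import Literature.MathematicalPhysics.KineticTheory.LambertianHardSphereFlow
import Summits.AtomisticToContinuum.HydrodynamicLimit.Theses.LambertianContactSwap

/-!
# CERTIFICATION SCRATCH (crux-strategist, stmt-AtomisticToContinuum-11854): the deciding theorem of route `LambertianContactSwap`
# AFTER the recommended tenure edit "re-type the crux `LambertianEuler` with the conjunct's packing guard"

This file emulates the route file after `ledger route edit route-AtomisticToContinuum-LambertianContactSwap --restate LambertianEuler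
--new-decl-name LambertianEulerInBand --statement @inband_statement.txt …` (or the equivalent `--split` child / `add_items`): it re-opens the
route namespace, declares the guarded item `LambertianEulerInBand` with EXACTLY the statement text of `split/children.json` / `inband_statement.txt`
(named Λ-API, one extra import `Literature.MathematicalPhysics.KineticTheory.LambertianHardSphereFlow`), and proves the deciding theorem
`closesInBand (hS : SwapGap) (hL : LambertianEulerInBand) : _root_.HydrodynamicLimit` — the text a tenure planner passes as `--closes-file`
(with `--closes closesInBand`, or renamed `closes`).  Proof = the route's certified `closes` (rev 8) with (i) the packing threshold `η₀ := η_Λ`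
(the band of the guarded item) instead of `1`, (ii) the guard handed to the item instead of discarded, and (iii) a ten-line in-proof bridge
from the named Λ-API to the route's inline `let` block (`have hLi : <inline form> := by intro <lets> …; exact …`, the cheap definitional
direction, pattern of `…EntropyToHydro.stub_entropyToHydroLambda` p106285), so that the Portmanteau step matches `SwapGap`'s Λ-terms
syntactically after zeta-reduction exactly as in rev 8.  `lean check`: see census §Decomposition.  Nothing here is recorded in the ledger.
-/

namespace Summit.AtomisticToContinuum.HydrodynamicLimit.Theses.LambertianContactSwap

open scoped BigOperators Topology Manifold Classical MeasureTheory ProbabilityTheory Matrix InnerProductSpace ComplexConjugate ContinuousMap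
open Filter Set Function TopologicalSpace MeasureTheory

/-- [crux] EULER FOR THE LAMBERTIAN GAS, PACKING-GUARDED — the proposed re-typing of `LambertianEuler` (statement text = split/children.json
child 1 = inband_statement.txt; verbatim the body of `…Theorems.LambertianContactSwapLambertianEulerHeartsLog.LambertianEulerInBand`, p137612). -/
def LambertianEulerInBand : Prop :=
  ∃ η₀ : ℝ, 0 < η₀ ∧ ∀ (a₀ θ₀ : Literature.MathematicalPhysics.KineticTheory.T3 → ℝ) (u₀ : Literature.MathematicalPhysics.KineticTheory.T3 → Literature.MathematicalPhysics.KineticTheory.V3), Continuous a₀ → Continuous θ₀ → Continuous u₀ → (∀ x, 0 < a₀ x) → (∀ x, 0 < θ₀ x) → ∃ σ₀ : ℝ, 0 < σ₀ ∧ ∀ σ : ℝ, 0 < σ → σ < σ₀ → ∀ (T : ℝ) (ρ θ : ℝ → Literature.MathematicalPhysics.KineticTheory.T3 → ℝ) (u : ℝ → Literature.MathematicalPhysics.KineticTheory.T3 → Literature.MathematicalPhysics.KineticTheory.V3), Literature.MathematicalPhysics.KineticTheory.IsHardSphereEulerSolution σ T ρ u θ → (∀ t ∈ Set.Ico 0 T,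 ∀ x, ρ t x * σ ^ 3 < η₀) → ∀ Φ : (N : ℕ) → Literature.Analysis.FluidPDE.HardSphereFlow (Literature.Analysis.FluidPDE.Torus.geometry (Fin 3)) (Literature.MathematicalPhysics.KineticTheory.hsDiameter σ N) (N + 1), Literature.MathematicalPhysics.KineticTheory.TendstoHydroFieldsAt (fun N => Literature.MathematicalPhysics.KineticTheory.localGibbsLaw σ a₀ u₀ θ₀ N (Φ N)) Φ ρ u θ 0 → ∀ t ∈ Set.Ico 0 T, ∀ χ : Literature.MathematicalPhysics.KineticTheory.T3 → ℝ, Continuous χ → ∀ δ > (0 : ℝ), Filter.Tendsto (fun N : ℕ => ((Literature.MathematicalPhysics.KineticTheory.localGibbsLaw σ a₀ u₀ θ₀ N (Φ N)).prod (Literature.MathematicalPhysics.KineticTheory.lambertNoise (Fin 3))) {p | δ < |Literature.MathematicalPhysics.KineticTheory.empiricalDensityField (Literature.MathematicalPhysics.KineticTheory.lambertFlow (Literature.Analysis.FluidPDE.Torus.geometry (Fin 3)) (Literature.MathematicalPhysics.KineticTheory.hsDiameter σ N) p.2 p.1 t) χ - ∫ x, χ x * ρ t x|}) Filter.atTop (nhds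 0) ∧ Filter.Tendsto (fun N : ℕ => ((Literature.MathematicalPhysics.KineticTheory.localGibbsLaw σ a₀ u₀ θ₀ N (Φ N)).prod (Literature.MathematicalPhysics.KineticTheory.lambertNoise (Fin 3))) {p | δ < ‖Literature.MathematicalPhysics.KineticTheory.empiricalMomentumField (Literature.MathematicalPhysics.KineticTheory.lambertFlow (Literature.Analysis.FluidPDE.Torus.geometry (Fin 3)) (Literature.MathematicalPhysics.KineticTheory.hsDiameter σ N) p.2 p.1 t) χ - ∫ x, (χ x * ρ t x) • u t x‖}) Filter.atTop (nhds 0) ∧ Filter.Tendsto (fun N : ℕ => ((Literature.MathematicalPhysics.KineticTheory.localGibbsLaw σ a₀ u₀ θ₀ N (Φ N)).prod (Literature.MathematicalPhysics.KineticTheory.lambertNoise (Fin 3))) {p | δ < |Literature.MathematicalPhysics.KineticTheory.empiricalEnergyField (Literature.MathematicalPhysics.KineticTheory.lambertFlow (Literature.Analysis.FluidPDE.Torus.geometry (Fin 3)) (Literature.MathematicalPhysics.KineticTheory.hsDiameter σ N) p.2 p.1 t) χ - ∫ x, χ x * Literature.MathematicalPhysics.KineticTheory.totalEnergyDensity (ρ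 t x) (u t x) (θ t x)|}) Filter.atTop (nhds 0)

set_option maxHeartbeats 400000 in -- one declaration = in-proof bridge (named Λ-API → inline `let`s) + the rev-8 Portmanteau proof; each half fits the default alone
/-- The deciding theorem on the guarded item (to be passed as `--closes-file`; `--closes closesInBand` or rename to `closes`).
`η₀ := η_Λ`; `σ₀ := min σ_S σ_L`; Markov + `SwapGap` (bounded-Lipschitz merging, unguarded) + the guarded Euler limit of `Λ` at `δ/2`.
[cite: Billingsley1999, Thm 2.1] [cite: OllaVaradhanYau1993, §1] -/
theorem closesInBand (hS : SwapGap) (hL : LambertianEulerInBand) : _root_.HydrodynamicLimit := by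
  obtain ⟨ηL, hηL, hL⟩ := hL -- the band of the guarded item
  -- bridge: the guarded item over the route's inline `let` block (named `lambertFlow`/`lambertNoise` unfold onto the `let`-bound `lflow`/`noise`)
  have hLi : let Cfg : ℕ → Type := fun N => Literature.Analysis.FluidPDE.Config (N + 1) (Fin 3) (UnitAddTorus (Fin 3)); let G := Literature.Analysis.FluidPDE.Torus.geometry (Fin 3); let ε : ℝ → ℕ → ℝ := Literature.MathematicalPhysics.KineticTheory.hsDiameter; let τ : ℝ → (N : ℕ) → Cfg N → ENNReal := fun σ N z => Literature.Analysis.FluidPDE.Alexander.freeExitTime G (ε σ N) z; let S : ℝ → (N : ℕ) → Cfg N → Cfg N := fun t _ z => Literature.Analysis.FluidPDE.freeFlight G t z; let ldir : EuclideanSpace ℝ (Fin 3) → EuclideanSpace ℝ (Fin 3) → EuclideanSpace ℝ (Fin 3) := fun ω ξ => ‖‖ω‖⁻¹ • ω + ‖ξ‖⁻¹ • ξ‖⁻¹ • (‖ω‖⁻¹ • ω + ‖ξ‖⁻¹ • ξ); let lpair : (N : ℕ) → Fin (N + 1) → Fin (N + 1) → Cfg N → EuclideanSpace ℝ (Fin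 3) → Cfg N := fun _ i j z ξ => let c := (2 : ℝ)⁻¹ • ((z i).2 + (z j).2); let w := (‖(z i).2 - (z j).2‖ / 2) • ldir (G.sepVec (z i).1 (z j).1) ξ; Function.update (Function.update z i ((z i).1, c + w)) j ((z j).1, c - w); let lstep : ℝ → (N : ℕ) → EuclideanSpace ℝ (Fin 3) → Cfg N → Cfg N := fun σ N ξ z => let z' := S (τ σ N z).toReal N z; if τ σ N z = ⊤ then z else if h : (Literature.Analysis.FluidPDE.Alexander.incomingPairs G (ε σ N) z').Nonempty then lpair N h.some.1 h.some.2 z' ξ else z'; let lstate : ℝ → (N : ℕ) → (ℕ → EuclideanSpace ℝ (Fin 3)) → Cfg N → ℕ → Cfg N := fun σ N ξs z k => ((fun p : Cfg N × ℕ => (lstep σ N (ξs p.2) p.1, p.2 + 1))^[k] (z, 0)).1; let linst : ℝ → (N : ℕ) → (ℕ → EuclideanSpace ℝ (Fin 3)) → Cfg N → ℕ → ENNReal := fun σ N ξs z k => ∑ m ∈ Finset.range k, τ σ N (lstate σ N ξs z m); let lflow : ℝ → (N : ℕ) → (ℕ → EuclideanSpace ℝ (Fin 3)) → Cfg N → ℝ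 → Cfg N := fun σ N ξs z t => let K := sSup {k : ℕ | linst σ N ξs z k ≤ ENNReal.ofReal t}; S (t - (linst σ N ξs z K).toReal) N (lstate σ N ξs z K); let noise : MeasureTheory.Measure (ℕ → EuclideanSpace ℝ (Fin 3)) := MeasureTheory.Measure.infinitePi (fun _ : ℕ => ProbabilityTheory.stdGaussian (EuclideanSpace ℝ (Fin 3))); ∀ (a₀ θ₀ : (UnitAddTorus (Fin 3)) → ℝ) (u₀ : (UnitAddTorus (Fin 3)) → EuclideanSpace ℝ (Fin 3)), Continuous a₀ → Continuous θ₀ → Continuous u₀ → (∀ x, 0 < a₀ x) → (∀ x, 0 < θ₀ x) → ∃ σ₀ : ℝ, 0 < σ₀ ∧ ∀ σ : ℝ, 0 < σ → σ < σ₀ → ∀ (T : ℝ) (ρ θ : ℝ → (UnitAddTorus (Fin 3)) → ℝ) (u : ℝ → (UnitAddTorus (Fin 3)) → EuclideanSpace ℝ (Fin 3)), Literature.MathematicalPhysics.KineticTheory.IsHardSphereEulerSolution σ T ρ u θ → (∀ t ∈ Set.Ico 0 T, ∀ x, ρ t x * σ ^ 3 < ηL) → ∀ Φ : (N : ℕ)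 → Literature.Analysis.FluidPDE.HardSphereFlow G (ε σ N) (N + 1), let P := fun N => Literature.MathematicalPhysics.KineticTheory.localGibbsLaw σ a₀ u₀ θ₀ N (Φ N); Literature.MathematicalPhysics.KineticTheory.TendstoHydroFieldsAt P Φ ρ u θ 0 → ∀ t ∈ Set.Ico 0 T, ∀ χ : (UnitAddTorus (Fin 3)) → ℝ, Continuous χ → ∀ δ > (0 : ℝ), Filter.Tendsto (fun N : ℕ => ((P N).prod noise) {p | δ < |Literature.MathematicalPhysics.KineticTheory.empiricalDensityField (lflow σ N p.2 p.1 t) χ - ∫ x, χ x * ρ t x|}) Filter.atTop (nhds 0) ∧ Filter.Tendsto (fun N : ℕ => ((P N).prod noise) {p | δ < ‖Literature.MathematicalPhysics.KineticTheory.empiricalMomentumField (lflow σ N p.2 p.1 t) χ - ∫ x, (χ x * ρ t x) • u t x‖}) Filter.atTop (nhds 0) ∧ Filter.Tendsto (fun N : ℕ => ((P N).prod noise) {p | δ < |Literature.MathematicalPhysics.KineticTheory.empiricalEnergyField (lflow σ N p.2 p.1 t) χ - ∫ x, χ x * Literature.MathematicalPhysics.KineticTheory.totalEnergyDensity (ρ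 t x) (u t x) (θ t x)|}) Filter.atTop (nhds 0) := by
    intro Cfg G ε τ S ldir lpair lstep lstate linst lflow noise a₀ θ₀ u₀ ha hθ hu ha0 hθ0
    obtain ⟨σ₀, hσ₀, H⟩ := hL a₀ θ₀ u₀ ha hθ hu ha0 hθ0
    refine ⟨σ₀, hσ₀, fun σ hσ hσ' T ρ θ u hE hg Φ h0 t ht χ hχ δ hδ => ?_⟩
    exact H σ hσ hσ' T ρ θ u hE hg Φ h0 t ht χ hχ δ hδ
  clear hL
  refine ⟨ηL, hηL, ?_⟩ -- packing threshold `η₀ := η_Λ`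
  intro a₀ θ₀ u₀ ha hθ hu ha0 hθ0
  obtain ⟨σS, hσS, hS'⟩ := hS a₀ θ₀ u₀ ha hθ hu ha0 hθ0
  obtain ⟨σL, hσL, hL'⟩ := hLi a₀ θ₀ u₀ ha hθ hu ha0 hθ0
  refine ⟨min σS σL, lt_min hσS hσL, ?_⟩
  intro σ hσ hσlt T ρ θ u hE hη Φ h0 t ht χ hχ δ hδ -- `hη`: the packing guard, USED
  have hSw := hS' σ hσ (hσlt.trans_le (min_le_left _ _)) T ρ θ u hE Φ h0 t ht χ hχ
  have hLa := hL' σ hσ (hσlt.trans_le (min_le_right _ _)) T ρ θ u hE hη Φ h0 t ht χ hχ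
  clear hS' hL'
  -- abstract merging transfer: finite `μ n`, measurable real `X n`, arbitrary real `Y n`
  have key : ∀ {α β : ℕ → Type} [∀ n, MeasurableSpace (α n)] [∀ n, MeasurableSpace (β n)]
      (μ : ∀ n, Measure (α n)) (ν : ∀ n, Measure (β n)), (∀ n, IsFiniteMeasure (μ n)) →
      ∀ (X : ∀ n, α n → ℝ) (Y : ∀ n, β n → ℝ), (∀ n, Measurable (X n)) →
      (∀ g : ℝ → ℝ, LipschitzWith 1 g → (∀ y, |g y| ≤ 1) →
        Tendsto (fun n => (∫ z, g (X n z) ∂μ n) - ∫ p, g (Y n p) ∂ν n) atTop (𝓝 0)) →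
      (∀ δ' : ℝ, 0 < δ' → Tendsto (fun n => ν n {p | δ' < Y n p}) atTop (𝓝 0)) →
      ∀ δ' : ℝ, 0 < δ' → Tendsto (fun n => μ n {z | δ' < X n z}) atTop (𝓝 0) := by
    intro α β _ _ μ ν hμ X Y hX hswap hY δ hδ
    obtain ⟨g, hgl, hga, hg0, hg1, hgz, hgδ⟩ : ∃ g : ℝ → ℝ, LipschitzWith 1 g ∧ (∀ x, |g x| ≤ 1) ∧
        (∀ x, 0 ≤ g x) ∧ (∀ x, g x ≤ 1) ∧ (∀ x, x ≤ δ / 2 → g x = 0) ∧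
        (∀ x, δ < x → min 1 (δ / 2) ≤ g x) := by
      have hnn : ∀ x : ℝ, 0 ≤ min 1 (max (x - δ / 2) 0) :=
        fun x => le_min zero_le_one (le_max_right _ _)
      refine ⟨fun x => min 1 (max (x - δ / 2) 0), ?_, ?_, hnn, fun x => min_le_left _ _, ?_, ?_⟩
      · refine LipschitzWith.mk_one fun x y => ?_
        rw [Real.dist_eq, Real.dist_eq]
        calc |min 1 (max (x - δ / 2) 0) - min 1 (max (y - δ / 2) 0)|
            ≤ max |(1 : ℝ) - 1| |max (x - δ / 2) 0 - max (y - δ / 2) 0| :=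
              abs_min_sub_min_le_max _ _ _ _
          _ = |max (x - δ / 2) 0 - max (y - δ / 2) 0| := by
              rw [sub_self, abs_zero, max_eq_right (abs_nonneg _)]
          _ ≤ |x - δ / 2 - (y - δ / 2)| := abs_max_sub_max_le_abs _ _ _
          _ = |x - y| := by rw [sub_sub_sub_cancel_right]
      · exact fun x => by rw [abs_of_nonneg (hnn x)]; exact min_le_left _ _
      · exact fun x hx => show min 1 (max (x - δ / 2) 0) = 0 by
          rw [max_eq_right (sub_nonpos.2 hx), min_eq_right zero_le_one]
      · exact fun x hx => le_min (min_le_left _ _)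
          ((min_le_right _ _).trans (le_max_of_le_left (by linarith)))
    have hκ : 0 < min 1 (δ / 2) := lt_min one_pos (half_pos hδ)
    have hb0 : ∀ n, 0 ≤ ∫ p, g (Y n p) ∂ν n := fun n => integral_nonneg fun p => hg0 _
    have hb_le : ∀ n, ENNReal.ofReal (∫ p, g (Y n p) ∂ν n) ≤ ν n {p | δ / 2 < Y n p} := by
      intro n
      have h1 : ENNReal.ofReal (∫ p, g (Y n p) ∂ν n) ≤ ∫⁻ p, ENNReal.ofReal (g (Y n p)) ∂ν n := by
        by_cases hf : Integrable (fun p => g (Y n p)) (ν n)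
        · rw [ofReal_integral_eq_lintegral_ofReal hf (Eventually.of_forall fun p => hg0 _)]
        · rw [integral_undef hf, ENNReal.ofReal_zero]
          exact zero_le
      refine h1.trans ((lintegral_mono fun p => ?_).trans (lintegral_indicator_one_le _))
      by_cases hp : δ / 2 < Y n p
      · rw [Set.indicator_of_mem (show p ∈ {p | δ / 2 < Y n p} from hp), Pi.one_apply]
        exact ENNReal.ofReal_le_one.2 (hg1 _)
      · rw [Set.indicator_of_notMem (show p ∉ {p | δ / 2 < Y n p} from hp),
          hgz _ (not_lt.1 hp), ENNReal.ofReal_zero]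
    have hb : Tendsto (fun n => ∫ p, g (Y n p) ∂ν n) atTop (𝓝 0) := by
      have h1 : Tendsto (fun n => ENNReal.ofReal (∫ p, g (Y n p) ∂ν n)) atTop (𝓝 0) :=
        tendsto_of_tendsto_of_tendsto_of_le_of_le tendsto_const_nhds (hY _ (half_pos hδ))
          (fun n => zero_le) hb_le
      exact ((ENNReal.tendsto_toReal_zero_iff (fun n => ENNReal.ofReal_ne_top)).2 h1).congr
        fun n => ENNReal.toReal_ofReal (hb0 n)
    have ha : Tendsto (fun n => ∫ z, g (X n z) ∂μ n) atTop (𝓝 0) := by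
      simpa using (hswap g hgl hga).add hb
    have hA : ∀ n, MeasurableSet {z | δ < X n z} :=
      fun n => measurableSet_lt measurable_const (hX n)
    have ha_ge : ∀ n, min 1 (δ / 2) * (μ n {z | δ < X n z}).toReal ≤ ∫ z, g (X n z) ∂μ n := by
      intro n
      haveI := hμ n
      have hint : Integrable (fun z => g (X n z)) (μ n) :=
        Integrable.of_bound (hgl.continuous.measurable.comp (hX n)).aestronglyMeasurable 1
          (Eventually.of_forall fun z => by rw [Real.norm_eq_abs]; exact hga (X n z))
      calc min 1 (δ / 2) * (μ n {z | δ < X n z}).toReal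
          = ∫ z, {z | δ < X n z}.indicator (fun _ => min 1 (δ / 2)) z ∂μ n := by
            rw [integral_indicator_const _ (hA n), smul_eq_mul, measureReal_def, mul_comm]
        _ ≤ ∫ z, g (X n z) ∂μ n := by
            refine integral_mono ((integrable_const _).indicator (hA n)) hint fun z => ?_
            by_cases hz : δ < X n z
            · rw [Set.indicator_of_mem (show z ∈ {z | δ < X n z} from hz)]
              exact hgδ _ hz
            · rw [Set.indicator_of_notMem (show z ∉ {z | δ < X n z} from hz)]
              exact hg0 _
    refine (ENNReal.tendsto_toReal_zero_iff fun n => ?_).1 ?_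
    · haveI := hμ n
      exact measure_ne_top _ _
    have h0 : Tendsto (fun n => (min 1 (δ / 2))⁻¹ * ∫ z, g (X n z) ∂μ n) atTop (𝓝 0) := by
      simpa using ha.const_mul (min 1 (δ / 2))⁻¹
    refine tendsto_of_tendsto_of_tendsto_of_le_of_le tendsto_const_nhds h0
      (fun n => ENNReal.toReal_nonneg) fun n => ?_
    rw [le_inv_mul_iff₀ hκ]
    exact ha_ge n
  -- local Gibbs laws are finite for all `σ, N`: `1_D f₀^⊗(N+1)` integrable, or `𝒵 = 0` (zero law)
  have aux : ∀ {α : Type} [MeasureSpace α] (f : α → ℝ) (s : Set α),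
      ∫⁻ z in s, ENNReal.ofReal ((∫ z, f z)⁻¹ * f z) < ⊤ := by
    intro α _ f s
    by_cases hint : Integrable f volume
    · exact lt_of_le_of_lt (lintegral_mono' Measure.restrict_le_self fun z => Real.ofReal_le_enorm _)
        (hasFiniteIntegral_iff_enorm.1 (hint.const_mul _).hasFiniteIntegral)
    · simp [integral_undef hint]
  have hfinP : ∀ N, IsFiniteMeasure (Literature.MathematicalPhysics.KineticTheory.localGibbsLaw σ a₀ u₀ θ₀ N (Φ N)) := fun N =>
    ⟨by
      show (volume.restrict _).withDensity _ Set.univ < ⊤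
      rw [withDensity_apply _ MeasurableSet.univ, Measure.restrict_univ]
      exact aux _ _⟩
  -- measurability of the empirical fields (finite averages, `χ` continuous)
  have hpos : ∀ {N : ℕ} (i : Fin (N + 1)),
      Measurable fun z : Literature.Analysis.FluidPDE.Config (N + 1) (Fin 3) (UnitAddTorus (Fin 3)) => (z i).1 :=
    fun i => (measurable_pi_apply i).fst
  have hvel : ∀ {N : ℕ} (i : Fin (N + 1)),
      Measurable fun z : Literature.Analysis.FluidPDE.Config (N + 1) (Fin 3) (UnitAddTorus (Fin 3)) => (z i).2 :=
    fun i => (measurable_pi_apply i).snd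
  have hmD : ∀ N, Measurable fun z => Literature.MathematicalPhysics.KineticTheory.empiricalDensityField (N := N + 1) z χ := by
    intro N
    rw [show (fun z => Literature.MathematicalPhysics.KineticTheory.empiricalDensityField (N := N + 1) z χ) =
        fun z => ((N + 1 : ℕ) : ℝ)⁻¹ * ∑ i, χ (z i).1 from
      funext fun z => Literature.Analysis.FluidPDE.integral_empiricalMeasure z fun y => χ y.1]
    exact measurable_const.mul (Finset.measurable_sum _ fun i _ => hχ.measurable.comp (hpos i))
  have hmM : ∀ N, Measurable fun z => Literature.MathematicalPhysics.KineticTheory.empiricalMomentumField (N := N + 1) z χ := by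
    intro N
    have heq : (fun z => Literature.MathematicalPhysics.KineticTheory.empiricalMomentumField (N := N + 1) z χ) =
        fun z => (((N + 1 : ℕ) : ENNReal)⁻¹).toReal • ∑ i, χ (z i).1 • (z i).2 := by
      funext z
      show ∫ y, χ y.1 • y.2 ∂(Literature.Analysis.FluidPDE.empiricalMeasure z) = _
      rw [Literature.Analysis.FluidPDE.empiricalMeasure_eq, integral_smul_measure,
        integral_finsetSum_measure fun i _ => integrable_dirac enorm_lt_top]
      simp only [integral_dirac]
    rw [heq]
    exact (Finset.measurable_sum Finset.univ fun i _ =>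
      (hχ.measurable.comp (hpos i)).fun_smul (hvel i)).fun_const_smul _
  have hmE : ∀ N, Measurable fun z => Literature.MathematicalPhysics.KineticTheory.empiricalEnergyField (N := N + 1) z χ := by
    intro N
    rw [show (fun z => Literature.MathematicalPhysics.KineticTheory.empiricalEnergyField (N := N + 1) z χ) =
        fun z => ((N + 1 : ℕ) : ℝ)⁻¹ * ∑ i, χ (z i).1 * (‖(z i).2‖ ^ 2 / 2) from
      funext fun z => Literature.Analysis.FluidPDE.integral_empiricalMeasure z fun y => χ y.1 * (‖y.2‖ ^ 2 / 2)]
    exact measurable_const.mul (Finset.measurable_sum _ fun i _ =>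
      (hχ.measurable.comp (hpos i)).mul (((hvel i).norm.pow_const 2).div_const 2))
  -- `1`-Lipschitz maps do not increase distances; the elementary test functions
  have hdl : ∀ {α β : Type} [PseudoMetricSpace α] [PseudoMetricSpace β] (f : α → β),
      LipschitzWith 1 f → ∀ x y, dist (f x) (f y) ≤ dist x y :=
    fun f hf x y => by simpa using hf.dist_le_mul x y
  have habs : ∀ c : ℝ, LipschitzWith 1 fun x : ℝ => |x - c| :=
    fun c => by simpa only [Real.dist_eq] using LipschitzWith.dist_left c
  have hnrm : ∀ c : (EuclideanSpace ℝ (Fin 3)), LipschitzWith 1 fun x : (EuclideanSpace ℝ (Fin 3)) => ‖x - c‖ :=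
    fun c => by simpa only [dist_eq_norm] using LipschitzWith.dist_left c
  -- the three transfers (density, momentum, energy)
  refine ⟨?_, ?_, ?_⟩
  · exact key _ _ hfinP
      (fun N z => |Literature.MathematicalPhysics.KineticTheory.empiricalDensityField ((Φ N).flow t z) χ - ∫ x, χ x * ρ t x|) _
      (fun N => (((hmD N).comp ((Φ N).measurable_flow t)).sub measurable_const).abs)
      (fun g hg hg1 => hSw (fun y => g |y.1 - _|) (LipschitzWith.mk_one fun y y' =>
        (hdl g hg _ _).trans <| (hdl _ (habs _) _ _).trans (hdl _ LipschitzWith.prod_fst y y'))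
        fun y => hg1 _)
      (fun δ' hδ' => (hLa δ' hδ').1) δ hδ
  · exact key _ _ hfinP
      (fun N z => ‖Literature.MathematicalPhysics.KineticTheory.empiricalMomentumField ((Φ N).flow t z) χ - ∫ x, (χ x * ρ t x) • u t x‖) _
      (fun N => (((hmM N).comp ((Φ N).measurable_flow t)).sub measurable_const).norm)
      (fun g hg hg1 => hSw (fun y => g ‖y.2.1 - _‖) (LipschitzWith.mk_one fun y y' =>
        (hdl g hg _ _).trans <| (hdl _ (hnrm _) _ _).trans <|
          (hdl _ LipschitzWith.prod_fst y.2 y'.2).trans (hdl _ LipschitzWith.prod_snd y y'))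
        fun y => hg1 _)
      (fun δ' hδ' => (hLa δ' hδ').2.1) δ hδ
  · exact key _ _ hfinP (fun N z => |Literature.MathematicalPhysics.KineticTheory.empiricalEnergyField ((Φ N).flow t z) χ -
        ∫ x, χ x * Literature.MathematicalPhysics.KineticTheory.totalEnergyDensity (ρ t x) (u t x) (θ t x)|) _
      (fun N => (((hmE N).comp ((Φ N).measurable_flow t)).sub measurable_const).abs)
      (fun g hg hg1 => hSw (fun y => g |y.2.2 - _|) (LipschitzWith.mk_one fun y y' =>
        (hdl g hg _ _).trans <| (hdl _ (habs _) _ _).trans <|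
          (hdl _ LipschitzWith.prod_snd y.2 y'.2).trans (hdl _ LipschitzWith.prod_snd y y'))
        fun y => hg1 _)
      (fun δ' hδ' => (hLa δ' hδ').2.2) δ hδ

end Summit.AtomisticToContinuum.HydrodynamicLimit.Theses.LambertianContactSwap
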